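import Mathlib
import HarnessLib

/-!
# Algorithm 1 for `SU(3)`: three eigen-phases of sum zero, off the walls, are carried by a unique lattice shift of sum zero into a unique Weyl chamber of the alcove

HONEST FRAMING: exact (Metropolis-corrected) sampling algorithms for lattice gauge theory;
figures of merit are autocorrelation/cost numbers at stated couplings and volumes; no
continuum-physics claim.

Venture `LatticeQCDFlow` (cell pub-lqcd), topic `Exactness`; FANOUT row 10 (`eng-equiv`, engine
`latflow.equiv` `spectral.canonicalise` / `uncanonicalise`, Boyda et al., PRD 103 (2021) 074504,
App. B Algorithm 1: "reduce the eigen-phases mod `2π`, `S = Σ/2π ∈ {−1, 0, 1}`, shift the `|S|`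
extreme phases by `∓2π`, sort — the result lies in the canonical cell
`x₁ < x₂ < x₃ < x₁ + 2π`, `Σ x = 0`, and the sorting permutation is remembered").  NEW WORK of the
cell, elementary real analysis over Mathlib (`toIocMod` / `toIocDiv`, `Tuple.sort`,
`Tuple.unique_monotone`).  Nothing is cited as a fact; no number; no definition.  The combinatorial
heart of step 2b of the `N = 3` alcove programme (LEANMAP-eng-equiv-gen8 §C′): the six chambers
`{y ∘ τ in the chain}`, `τ ∈ S₃`, tile the plane `Σ y = 0` under the lattice of shifts
`2π m`, `m ∈ ℤ³`, `Σ m = 0`, up to the walls.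

## What is typed (period `c > 0`, later `c = 2π`; `y : Fin 3 → ℝ`; the CHAIN of `y` along
`τ ∈ S₃` is `y (τ 0) < y (τ 1) < y (τ 2) < y (τ 0) + c`)

* `exists_perm_alcoveChain_of_pairwise` — three pairwise distinct reals with pairwise distances
  `< c` are in the chain along the sorting permutation;
* `injective_of_alcoveChain`, `abs_sub_lt_of_alcoveChain` — conversely a chain has distinct entries
  at pairwise distances `< c`;
* **`perm_eq_of_alcoveChain`** — the chamber is unique: two chains for the same `y` have the same
  permutation (the six chambers are pairwise disjoint);
* **`latticeShift_eq_zero_of_pairwise`** — UNIQUENESS of the lattice shift: if `y` and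
  `y + c·m` (`m ∈ ℤ³`, `Σ m = 0`) both have pairwise distances `< c`, then `m = 0`;
* **`exists_latticeShift_pairwise`**, **`exists_latticeShift_alcoveChain`** — EXISTENCE
  (Algorithm 1): if `Σ y = 0` and no difference `y i − y j`, `i ≠ j`, is an integer multiple of `c`
  (off the walls), there is `m ∈ ℤ³` with `Σ m = 0` such that `y + c·m` has pairwise distinct
  entries at pairwise distances `< c`, hence lies in a chamber.

NOT here: the measure-theoretic reading (the chambers form a fundamental domain of the angle
lattice, `SU3AlcoveFundamentalDomain.lean`) and the torus (`SU3TorusChamberDecomposition.lean`).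
-/

noncomputable section

namespace Summit.Ventures.LatticeQCDFlow.Exactness

open Finset

/-! ## Chains: sorting, distinctness, spread -/

/-- **Three pairwise distinct reals at pairwise distances `< c` lie in a chamber**: along the
sorting permutation `τ`, `y (τ 0) < y (τ 1) < y (τ 2) < y (τ 0) + c`. -/
theorem exists_perm_alcoveChain_of_pairwise {c : ℝ} (y : Fin 3 → ℝ)
    (hne : ∀ i j, i ≠ j → y i ≠ y j) (hlt : ∀ i j, |y i - y j| < c) :
    ∃ τ : Equiv.Perm (Fin 3), y (τ 0) < y (τ 1) ∧ y (τ 1) < y (τ 2) ∧ y (τ 2) < y (τ 0) + c := by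
  have hinj : Function.Injective y := fun i j h => by
    by_contra hij
    exact hne i j hij h
  have hsm : StrictMono (y ∘ Tuple.sort y) :=
    (Tuple.monotone_sort y).strictMono_of_injective (hinj.comp (Tuple.sort y).injective)
  refine ⟨Tuple.sort y, hsm (show (0 : Fin 3) < 1 by decide), hsm (show (1 : Fin 3) < 2 by decide), ?_⟩
  have h := (abs_sub_lt_iff.mp (hlt (Tuple.sort y 2) (Tuple.sort y 0))).1
  linarith

/-- Along a chain the values are squeezed between the first and the last. -/
theorem mem_Icc_of_alcoveChain {y : Fin 3 → ℝ} {τ : Equiv.Perm (Fin 3)}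
    (h0 : y (τ 0) < y (τ 1)) (h1 : y (τ 1) < y (τ 2)) (i : Fin 3) :
    y (τ 0) ≤ y i ∧ y i ≤ y (τ 2) := by
  obtain ⟨k, rfl⟩ : ∃ k, τ k = i := ⟨τ.symm i, τ.apply_symm_apply i⟩
  fin_cases k
  · exact ⟨le_rfl, by simp only [Fin.zero_eta]; linarith⟩
  · exact ⟨by simp only [Fin.mk_one]; linarith, by simp only [Fin.mk_one]; linarith⟩
  · exact ⟨by simp only [Fin.reduceFinMk]; linarith, by simp only [Fin.reduceFinMk]; exact le_rfl⟩

/-- **A chain has pairwise distinct entries** (the phases off the walls). -/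
theorem injective_of_alcoveChain {y : Fin 3 → ℝ} {τ : Equiv.Perm (Fin 3)}
    (h0 : y (τ 0) < y (τ 1)) (h1 : y (τ 1) < y (τ 2)) : Function.Injective y := by
  have hsm : StrictMono (y ∘ τ) := by
    rw [Fin.strictMono_iff_lt_succ]
    intro i
    fin_cases i
    · simpa using h0
    · simpa using h1
  intro i j hij
  have h := hsm.injective (a₁ := τ.symm i) (a₂ := τ.symm j)
    (by simpa only [Function.comp_apply, Equiv.apply_symm_apply] using hij)
  simpa using congrArg τ h

/-- **A chain has pairwise distances `< c`.** -/
theorem abs_sub_lt_of_alcoveChain {c : ℝ} {y : Fin 3 → ℝ} {τ : Equiv.Perm (Fin 3)}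
    (h0 : y (τ 0) < y (τ 1)) (h1 : y (τ 1) < y (τ 2)) (h2 : y (τ 2) < y (τ 0) + c) (i j : Fin 3) :
    |y i - y j| < c := by
  obtain ⟨hi0, hi2⟩ := mem_Icc_of_alcoveChain h0 h1 i
  obtain ⟨hj0, hj2⟩ := mem_Icc_of_alcoveChain h0 h1 j
  rw [abs_sub_lt_iff]
  constructor <;> linarith

/-- **The chamber of a point is unique**: two chains for the same phases have the same
permutation — the six chambers `{y ∘ τ in the chain}`, `τ ∈ S₃`, are pairwise disjoint. -/
theorem perm_eq_of_alcoveChain {y : Fin 3 → ℝ} {τ τ' : Equiv.Perm (Fin 3)}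
    (h0 : y (τ 0) < y (τ 1)) (h1 : y (τ 1) < y (τ 2))
    (h0' : y (τ' 0) < y (τ' 1)) (h1' : y (τ' 1) < y (τ' 2)) : τ = τ' := by
  have hmono : ∀ {σ : Equiv.Perm (Fin 3)}, y (σ 0) < y (σ 1) → y (σ 1) < y (σ 2) → Monotone (y ∘ σ) := by
    intro σ hs0 hs1
    refine StrictMono.monotone ?_
    rw [Fin.strictMono_iff_lt_succ]
    intro i
    fin_cases i
    · simpa using hs0
    · simpa using hs1
  have heq := Tuple.unique_monotone (hmono h0 h1) (hmono h0' h1')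
  have hinj := injective_of_alcoveChain h0 h1
  ext i
  have hi := congr_fun heq i
  simp only [Function.comp_apply] at hi
  exact congrArg Fin.val (hinj hi)

/-! ## Uniqueness of the lattice shift -/

/-- **Uniqueness of the lattice shift.**  If `y` and `y + c·m` (`m ∈ ℤ³` with `Σ m = 0`) both have
pairwise distances `< c`, then `m = 0`: a nonzero `m` of sum zero has an entry `≥ 1` and an entry
`≤ −1`, moving one difference by at least `2c`. -/
theorem latticeShift_eq_zero_of_pairwise {c : ℝ} (hc : 0 < c) {y : Fin 3 → ℝ} {m : Fin 3 → ℤ}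
    (hm : ∑ i, m i = 0) (hy : ∀ i j, |y i - y j| < c)
    (hy' : ∀ i j, |(y i + m i * c) - (y j + m j * c)| < c) : m = 0 := by
  -- an entry `≥ 1` and an entry `≤ -1` are incompatible with the two spread bounds
  have key : ∀ i j, 1 ≤ m i → m j ≤ -1 → False := by
    intro i j hi hj
    have h1 := (abs_sub_lt_iff.mp (hy i j)).2
    have h2 := (abs_sub_lt_iff.mp (hy' i j)).1
    have hi' : (1 : ℝ) ≤ m i := by exact_mod_cast hi
    have hj' : (m j : ℝ) ≤ -1 := by exact_mod_cast hj
    have h2c : 2 * c ≤ ((m i : ℝ) - m j) * c := mul_le_mul_of_nonneg_right (by linarith) hc.le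
    nlinarith
  by_contra hne
  obtain ⟨i, hi⟩ : ∃ i, m i ≠ 0 := by
    by_contra h
    push Not at h
    exact hne (funext h)
  rcases lt_or_gt_of_ne hi with hneg | hpos
  · -- some other entry is positive
    obtain ⟨j, hj⟩ : ∃ j, 0 < m j := by
      by_contra h
      push Not at h
      have hall := (Finset.sum_eq_zero_iff_of_nonpos (s := Finset.univ) (f := m) fun k _ => h k).mp hm
      exact hi (hall i (Finset.mem_univ i))
    exact key j i (by omega) (by omega)
  · obtain ⟨j, hj⟩ : ∃ j, m j < 0 := by
      by_contra h
      push Not at h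
      have hall := (Finset.sum_eq_zero_iff_of_nonneg (s := Finset.univ) (f := m) fun k _ => h k).mp hm
      exact hi (hall i (Finset.mem_univ i))
    exact key i j (by omega) (by omega)

/-! ## Existence of the lattice shift (Algorithm 1) -/

/-- Off the walls, every lattice shift keeps the phases pairwise distinct. -/
theorem latticeShift_ne_of_offWalls {c : ℝ} {y : Fin 3 → ℝ}
    (hties : ∀ i j, i ≠ j → ∀ k : ℤ, y i - y j ≠ k * c) (m : Fin 3 → ℤ) (i j : Fin 3) (hij : i ≠ j) :
    y i + m i * c ≠ y j + m j * c := by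
  intro h
  refine hties i j hij (m j - m i) ?_
  push_cast
  linarith

/-- **Existence of the lattice shift (Algorithm 1).**  Let `Σ y = 0` and let no difference
`y i − y j`, `i ≠ j`, be an integer multiple of `c` (the phases are off the walls).  Then some
`m ∈ ℤ³` with `Σ m = 0` makes `y + c·m` pairwise distinct with pairwise distances `< c`.
Construction: reduce each `y i` into `(−c/2, c/2]`; the integer `S = −Σ(reduced)/c ∈ {−1, 0, 1}`;
for `S = 1` add `c` to the smallest reduced phase, for `S = −1` subtract `c` from the largest. -/
theorem exists_latticeShift_pairwise {c : ℝ} (hc : 0 < c) {y : Fin 3 → ℝ} (hsum : ∑ i, y i = 0)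
    (hties : ∀ i j, i ≠ j → ∀ k : ℤ, y i - y j ≠ k * c) :
    ∃ m : Fin 3 → ℤ, ∑ i, m i = 0 ∧ (∀ i j, i ≠ j → y i + m i * c ≠ y j + m j * c) ∧
      ∀ i j, |(y i + m i * c) - (y j + m j * c)| < c := by
  -- reduction of each phase into the window `(-c/2, c/2]`
  set n : Fin 3 → ℤ := fun i => toIocDiv hc (-(c / 2)) (y i) with hn
  set r : Fin 3 → ℝ := fun i => toIocMod hc (-(c / 2)) (y i) with hr
  have hr_mem : ∀ i, -(c / 2) < r i ∧ r i ≤ c / 2 := by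
    intro i
    have h := toIocMod_mem_Ioc hc (-(c / 2)) (y i)
    rw [show -(c / 2) + c = c / 2 by ring] at h
    exact h
  have hr_eq : ∀ i, r i = y i + (-n i : ℤ) * c := by
    intro i
    have h := toIocMod_add_toIocDiv_zsmul hc (-(c / 2)) (y i)
    rw [zsmul_eq_mul] at h
    push_cast
    simp only [hr, hn]
    linarith
  -- the reduced phases are pairwise distinct and within `c` of each other
  have hr_ne : ∀ i j, i ≠ j → r i ≠ r j := by
    intro i j hij
    rw [hr_eq, hr_eq]
    exact latticeShift_ne_of_offWalls hties (fun i => -n i) i j hij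
  have hr_lt : ∀ i j, |r i - r j| < c := by
    intro i j
    obtain ⟨hi1, hi2⟩ := hr_mem i
    obtain ⟨hj1, hj2⟩ := hr_mem j
    rw [abs_sub_lt_iff]
    constructor <;> linarith
  -- the integer `N = Σ n ∈ {-1, 0, 1}` (`Σ r = -N c` and `|Σ r| < 3c/2`)
  obtain ⟨N, hN⟩ : ∃ N : ℤ, ∑ i, n i = N := ⟨_, rfl⟩
  have hsum_r : ∑ i, r i = -(N : ℝ) * c := by
    have h : ∑ i, r i = ∑ i, (y i + (-n i : ℤ) * c) := Finset.sum_congr rfl fun i _ => hr_eq i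
    rw [h, Finset.sum_add_distrib, hsum, ← Finset.sum_mul, zero_add]
    congr 1
    push_cast
    rw [Finset.sum_neg_distrib, ← Int.cast_sum, hN]
  have hsum3 : ∑ i, r i = r 0 + r 1 + r 2 := Fin.sum_univ_three r
  have hN_lt : N < 2 := by
    have h0 := hr_mem 0; have h1 := hr_mem 1; have h2 := hr_mem 2
    by_contra h
    push Not at h
    have h' : (2 : ℝ) ≤ N := by exact_mod_cast h
    nlinarith
  have hN_gt : -2 < N := by
    have h0 := hr_mem 0; have h1 := hr_mem 1; have h2 := hr_mem 2
    by_contra h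
    push Not at h
    have h' : (N : ℝ) ≤ -2 := by exact_mod_cast h
    nlinarith
  -- a generic estimate: moving the phase `i₀` by `c` upwards keeps the spread `< c` when `r i₀`
  -- is the strict minimum, and symmetrically downwards for the strict maximum
  interval_cases N
  · -- `N = -1`: subtract `c` from the largest reduced phase
    obtain ⟨i₀, -, hmax⟩ := Finset.exists_max_image Finset.univ r Finset.univ_nonempty
    refine ⟨fun i => -n i - if i = i₀ then 1 else 0, ?_, latticeShift_ne_of_offWalls hties _, ?_⟩
    · rw [Finset.sum_sub_distrib, Finset.sum_neg_distrib, hN, Finset.sum_ite_eq']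
      simp
    · have hval : ∀ i, y i + ((-n i - if i = i₀ then 1 else 0 : ℤ) : ℝ) * c =
          r i - if i = i₀ then c else 0 := by
        intro i
        rw [hr_eq i]
        split_ifs <;> push_cast <;> ring
      intro i j
      rw [hval, hval]
      by_cases hi : i = i₀ <;> by_cases hj : j = i₀
      · subst hi; subst hj; simp [hc]
      · subst hi
        rw [if_pos rfl, if_neg hj]
        have hle := hmax j (Finset.mem_univ j)
        have hne' : r j ≠ r i := hr_ne j i hj
        have hlt' : r j < r i := lt_of_le_of_ne hle hne'
        have hd := (abs_sub_lt_iff.mp (hr_lt i j)).1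
        rw [abs_sub_lt_iff]
        constructor <;> linarith
      · subst hj
        rw [if_pos rfl, if_neg hi]
        have hle := hmax i (Finset.mem_univ i)
        have hne' : r i ≠ r j := hr_ne i j hi
        have hlt' : r i < r j := lt_of_le_of_ne hle hne'
        have hd := (abs_sub_lt_iff.mp (hr_lt i j)).2
        rw [abs_sub_lt_iff]
        constructor <;> linarith
      · rw [if_neg hi, if_neg hj, sub_zero, sub_zero]
        exact hr_lt i j
  · -- `N = 0`: the reduced phases themselves
    refine ⟨fun i => -n i, ?_, latticeShift_ne_of_offWalls hties _, ?_⟩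
    · rw [Finset.sum_neg_distrib, hN, neg_zero]
    · intro i j
      rw [← hr_eq, ← hr_eq]
      exact hr_lt i j
  · -- `N = 1`: add `c` to the smallest reduced phase
    obtain ⟨i₀, -, hmin⟩ := Finset.exists_min_image Finset.univ r Finset.univ_nonempty
    refine ⟨fun i => -n i + if i = i₀ then 1 else 0, ?_, latticeShift_ne_of_offWalls hties _, ?_⟩
    · rw [Finset.sum_add_distrib, Finset.sum_neg_distrib, hN, Finset.sum_ite_eq']
      simp
    · have hval : ∀ i, y i + ((-n i + if i = i₀ then 1 else 0 : ℤ) : ℝ) * c =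
          r i + if i = i₀ then c else 0 := by
        intro i
        rw [hr_eq i]
        split_ifs <;> push_cast <;> ring
      intro i j
      rw [hval, hval]
      by_cases hi : i = i₀ <;> by_cases hj : j = i₀
      · subst hi; subst hj; simp [hc]
      · subst hi
        rw [if_pos rfl, if_neg hj]
        have hle := hmin j (Finset.mem_univ j)
        have hne' : r i ≠ r j := hr_ne i j (Ne.symm hj)
        have hlt' : r i < r j := lt_of_le_of_ne hle hne'
        have hd := (abs_sub_lt_iff.mp (hr_lt i j)).2
        rw [abs_sub_lt_iff]
        constructor <;> linarith
      · subst hj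
        rw [if_pos rfl, if_neg hi]
        have hle := hmin i (Finset.mem_univ i)
        have hne' : r j ≠ r i := hr_ne j i (Ne.symm hi)
        have hlt' : r j < r i := lt_of_le_of_ne hle hne'
        have hd := (abs_sub_lt_iff.mp (hr_lt i j)).1
        rw [abs_sub_lt_iff]
        constructor <;> linarith
      · rw [if_neg hi, if_neg hj, add_zero, add_zero]
        exact hr_lt i j

/-- **Algorithm 1 lands in a chamber.**  Off the walls and with `Σ y = 0`, some lattice shift
`m ∈ ℤ³` of sum zero and some `τ ∈ S₃` put `y + c·m` in the chain
`· (τ 0) < · (τ 1) < · (τ 2) < · (τ 0) + c` — the canonical cell up to the remembered permutation. -/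
theorem exists_latticeShift_alcoveChain {c : ℝ} (hc : 0 < c) {y : Fin 3 → ℝ} (hsum : ∑ i, y i = 0)
    (hties : ∀ i j, i ≠ j → ∀ k : ℤ, y i - y j ≠ k * c) :
    ∃ m : Fin 3 → ℤ, ∑ i, m i = 0 ∧ ∃ τ : Equiv.Perm (Fin 3),
      y (τ 0) + m (τ 0) * c < y (τ 1) + m (τ 1) * c ∧
        y (τ 1) + m (τ 1) * c < y (τ 2) + m (τ 2) * c ∧
          y (τ 2) + m (τ 2) * c < y (τ 0) + m (τ 0) * c + c := by
  obtain ⟨m, hm, hne, hlt⟩ := exists_latticeShift_pairwise hc hsum hties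
  obtain ⟨τ, h0, h1, h2⟩ := exists_perm_alcoveChain_of_pairwise (fun i => y i + m i * c) hne hlt
  exact ⟨m, hm, τ, h0, h1, h2⟩

end Summit.Ventures.LatticeQCDFlow.Exactness
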